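import Mathlib
import Summits.Ventures.PercRepro2.V2SP
import Summits.Ventures.PercRepro2.LevelHarrisClosure

/-!
# The down-set Hall form (UH) of (U) holds on every series–parallel network
(seat mine-b, cell pub-perc-repro2; conjectures/MINE-B.md §20)

The series–parallel networks `SP` of V2SP.lean, with their configuration posets and flow labels
(minima for series, sums for parallel).  `V1ParallelClosure.lean` shows that down-set domination
`DownDom` is preserved by parallel composition, `V1SeriesClosure.lean` that it is preserved by
series composition in the presence of the capped Harris inequalities, and
`LevelHarrisClosure.lean` that the level Harris inequalities `LevelHarris` (which imply the capped
ones) are preserved by both compositions; the atoms satisfy both; hence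

  `SP.downDom : ∀ s : SP, DownDom s.rLab s.bLab`

— every lower set of the configuration poset of every series–parallel pattern carries non-negative
`ν`-mass, `ν = [r = 1] − b·[r = 0]`; by Hall's theorem (DownDomHall.lean) every configuration with
`F_R = 0`, `F_B = a` owns `a` private configurations below it with `F_R = 1`, and the count is (U).
-/

namespace Summit.Ventures.PercRepro2.V2Closure

open Finset
open Summit.Ventures.PercRepro2.UHClosure

/-- a level count on `Bool`, written out -/
theorem card_filter_bool (V : Finset Bool) (p : Bool → Prop) [DecidablePred p] :
    ((V.filter p).card : ℤ)
      = (if true ∈ V then (if p true then 1 else 0) else 0) + (if false ∈ V then (if p false then 1 else 0) else 0) := by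
  rw [Finset.card_filter]; push_cast; rw [sum_bool_eq]

/-- (UH) on a free edge: the red state (`ν = 1`) lies below the blue state (`ν = −1`). -/
theorem free_downDom' : DownDom freeR freeB := by
  intro V hV
  rw [sum_bool_eq]
  simp only [nu, freeR, freeB]
  by_cases ht : true ∈ V
  · have hf : false ∈ V := hV (show false ≤ true by decide) ht
    simp [hf, ht]
  · simp only [ht, if_false, zero_add]
    split_ifs <;> norm_num

/-- the level inequalities on a free edge: a lower set containing the blue state contains the red one -/
theorem free_levelHarris' : LevelHarris freeR freeB := by
  intro V hV j
  have : ((V.filter (fun c => j ≤ freeB c)).card : ℤ) ≤ ((V.filter (fun c => j ≤ freeR c)).card : ℤ) := by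
    rw [card_filter_bool, card_filter_bool]
    simp only [freeB, freeR, Bool.false_eq_true, if_true, if_false]
    by_cases ht : true ∈ V
    · have hf : false ∈ V := hV (show false ≤ true by decide) ht
      simp only [ht, hf, if_true]
      split_ifs <;> omega
    · simp only [ht, if_false, zero_add]
      split_ifs <;> omega
  exact_mod_cast this

/-- (UH) on a free edge. -/
theorem free_downDom : DownDom SP.free.rLab SP.free.bLab := free_downDom'

/-- the level inequalities on a free edge. -/
theorem free_levelHarris : LevelHarris SP.free.rLab SP.free.bLab := free_levelHarris'

/-- (UH) on a pinned edge: the single state has `ν = 1`. -/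
theorem pin_downDom : DownDom SP.pin.rLab SP.pin.bLab := by
  intro V _
  apply Finset.sum_nonneg
  intro c _
  simp [nu, SP.rLab]

/-- the level inequalities on a pinned edge: both counts agree. -/
theorem pin_levelHarris : LevelHarris SP.pin.rLab SP.pin.bLab := by
  intro V _ j
  simp [SP.rLab, SP.bLab]

/-- (UH) on an absent edge: `ν = 0`. -/
theorem absent_downDom : DownDom SP.absent.rLab SP.absent.bLab := by
  intro V _
  apply Finset.sum_nonneg
  intro c _
  simp [nu, SP.rLab, SP.bLab]

/-- the level inequalities on an absent edge: both counts agree. -/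
theorem absent_levelHarris : LevelHarris SP.absent.rLab SP.absent.bLab := by
  intro V _ j
  simp [SP.rLab, SP.bLab]

/-- **(UH) and the level Harris inequalities hold on every series–parallel network** (induction over
the network; the closure theorems `downDom_ser`, `downDom_par`, `levelHarris_ser`, `levelHarris_par`). -/
theorem SP.downDom_and_levelHarris : ∀ s : SP, DownDom s.rLab s.bLab ∧ LevelHarris s.rLab s.bLab
  | .free => ⟨free_downDom, free_levelHarris⟩
  | .pin => ⟨pin_downDom, pin_levelHarris⟩
  | .absent => ⟨absent_downDom, absent_levelHarris⟩
  | .ser s t =>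
      ⟨downDom_ser s.rLab s.bLab t.rLab t.bLab (SP.downDom_and_levelHarris s).1
          (capHarris_of_levelHarris _ _ (SP.downDom_and_levelHarris s).2)
          (SP.downDom_and_levelHarris t).1
          (capHarris_of_levelHarris _ _ (SP.downDom_and_levelHarris t).2),
       levelHarris_ser s.rLab s.bLab t.rLab t.bLab (SP.downDom_and_levelHarris s).2
          (SP.downDom_and_levelHarris t).2⟩
  | .par s t =>
      ⟨downDom_par s.rLab s.bLab t.rLab t.bLab (SP.downDom_and_levelHarris s).1
          (SP.downDom_and_levelHarris t).1,
       levelHarris_par s.rLab s.bLab t.rLab t.bLab (SP.downDom_and_levelHarris s).2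
          (SP.downDom_and_levelHarris t).2⟩

/-- **The down-set Hall form (UH) of (U) holds on every series–parallel pattern**: every lower set of
the configuration poset carries non-negative `ν`-mass. -/
theorem SP.downDom (s : SP) : DownDom s.rLab s.bLab := (SP.downDom_and_levelHarris s).1

/-- The count (U) of a series–parallel pattern is non-negative (the lower set `univ`). -/
theorem SP.sum_nu_nonneg (s : SP) : 0 ≤ ∑ c, nu s.rLab s.bLab c :=
  SP.downDom s univ (by simp [isLowerSet_univ])

end Summit.Ventures.PercRepro2.V2Closure
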